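import Summits.NavierStokesRegularity.FluidComputer.PalasekTowerRegisterGlobalFirstHitting

/-!
# REGISTER v2.3′: host-side corollaries of the anchor's bite, and the silence of `c₄ = 0` schedules

Cell `ns-blowup`, seat `ns-blowup-ecbridge-4` (g0); proof-only companion of
`PalasekTowerRegisterGlobalFirstHitting.lean` (p417307: for every globally anchored registered stage the
speed maximum at the first readout `τ₀` is EXACTLY `c₁ Y₀`, attained at a floor point `x₀` where
`ν |Du|² + ⟪u, ∇p⟫ ≤ ⟪u, f⟫ ≤ c₁ c₄ Y₀²`) and of the re-push / design-class files
`PalasekTowerRegisterGlobalDesign{,Slot}.lean` (planner RULING STATUS l.1890 on the split of the crux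
`EpisodeBaseG`, item stmt-NavierStokesRegularity-19179 of the route `PalasekTowerBreakdown`). LABEL:
E–C typing (KERNEL bookkeeping). WHAT THIS IS NOT: not Navier–Stokes evidence — necessary conditions and
schedule arithmetic; no host, stage or instance is constructed or claimed.

* Host side: `Stage.frobeniusNormSq_τ_zero_le` — `|Du (τ₀, x₀)|² ≤ c₁ Y₀ (c₄ Y₀ + ‖∇p (τ₀, x₀)‖) / ν`
  (strain at the first-hitting point is slaved to the pressure gradient there);
  `Stage.frobeniusNormSq_τ_zero_le_of_inner_gradient_nonneg` — a pressure-neutral floor point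
  (`⟪u, ∇p⟫ ≥ 0`, e.g. every purely azimuthal axisymmetric host, `∂_φ p = 0`) has
  `ν |Du|² ≤ c₁ c₄ Y₀²` (this excludes refuter K37's thin swirl torus from the v2.3′ register);
  `Stage.exists_continuation_of_extends` — the `(u, p)`-data a level-`(k+1)` extension hands back
  (converse of `Stage.nonempty_extends_of_continuation`, p415576): the target list of any first-episode
  statement.
* The push constant (planner OBJECTION l.1832, ecbridge-4 OBJECTION l.1875, RULING l.1890 (1)): the
  growth windows cover `[τ₀, T)` (`Schedule.exists_window_of_τ_zero_le`); at `c₄ = 0` every force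
  admissible for the schedule — or for a re-forcing at the SAME push constant — vanishes from `τ₀` on
  (`Schedule.admissible_eq_zero_of_c₄_eq_zero`, `Schedule.force_eq_zero_of_c₄_eq_zero`); and `c₄ = 0`
  is compatible with the registered pins (`Schedule.pins_of_c₄_eq_zero`; the registered schedule of
  record `TowerRates.exists_registered_schedule` has `c₄ = 0`). Hence a first-episode statement that
  re-forces at fixed `c₄` still contains, on these schedules, the UNFORCED level-0 heredity — the
  reason the surgery of record is a re-PUSH (`Schedule.repush`, new `c₄ ≤ c₁`).

References: S. Palasek, arXiv:2605.13827 §3.3, Rem. 1.4 [cite: Palasek2026ElementaryModel, §3.3].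
-/

noncomputable section

namespace Summit.NavierStokesRegularity.FluidComputer.PalasekTowerClayBridge

open Set MeasureTheory Filter Topology Function Real
open scoped ENNReal ContDiff NNReal InnerProductSpace RealInnerProductSpace
open Literature.Analysis.FluidPDE

/-! ## Host side: strain at the first-hitting point is slaved to the pressure gradient -/

namespace Stage

variable {ν : ℝ} {R : TowerRates} {S : Schedule R} {k : ℕ}

/-- **Strain at the first-hitting point is controlled by the pressure gradient there**: for `ν > 0`,
`|Du (τ₀, x₀)|² ≤ c₁ Y₀ (c₄ Y₀ + ‖∇p (τ₀, x₀)‖) / ν` at every level-`0` floor point (the anchor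
inequality `ν |Du|² + ⟪u, ∇p⟫ ≤ c₁ c₄ Y₀²`, Cauchy–Schwarz `⟪u, ∇p⟫ ≥ −‖u‖ ‖∇p‖` and
`‖u (τ₀, x₀)‖ = c₁ Y₀`). [folklore] -/
theorem frobeniusNormSq_τ_zero_le (s : Stage ν R S (Margins.routeG R) k) (hν : 0 < ν)
    {x₀ : EuclideanSpace ℝ (Fin 3)} (hx₀ : S.c₁ * R.Y 0 ≤ ‖s.u (S.τ 0) x₀‖) :
    frobeniusNormSq (fderiv ℝ (s.u (S.τ 0)) x₀) ≤
      S.c₁ * R.Y 0 * (S.c₄ * R.Y 0 + ‖gradient (s.p (S.τ 0)) x₀‖) / ν := by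
  have h1 := s.anchor_inequality_push hν.le hx₀
  have heq : ‖s.u (S.τ 0) x₀‖ = S.c₁ * R.Y 0 := s.norm_τ_zero_eq_of_floor hx₀
  have hcs : -(‖s.u (S.τ 0) x₀‖ * ‖gradient (s.p (S.τ 0)) x₀‖) ≤
      ⟪s.u (S.τ 0) x₀, gradient (s.p (S.τ 0)) x₀⟫ := by
    have := abs_real_inner_le_norm (s.u (S.τ 0) x₀) (gradient (s.p (S.τ 0)) x₀)
    have := neg_abs_le ⟪s.u (S.τ 0) x₀, gradient (s.p (S.τ 0)) x₀⟫
    linarith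
  rw [heq] at hcs
  rw [le_div_iff₀ hν]
  have : frobeniusNormSq (fderiv ℝ (s.u (S.τ 0)) x₀) * ν =
      ν * frobeniusNormSq (fderiv ℝ (s.u (S.τ 0)) x₀) := mul_comm _ _
  rw [this]
  nlinarith

/-- **Pressure-neutral floor points are nearly strain-free**: if the pressure gradient does no
positive work at the floor point (`⟪u, ∇p⟫ (τ₀, x₀) ≥ 0`; e.g. `∂_φ p = 0` for a purely azimuthal
axisymmetric host), then `ν |Du (τ₀, x₀)|² ≤ c₁ c₄ Y₀²` (`ν ≥ 0`). [folklore] -/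
theorem frobeniusNormSq_τ_zero_le_of_inner_gradient_nonneg (s : Stage ν R S (Margins.routeG R) k)
    (hν : 0 ≤ ν) {x₀ : EuclideanSpace ℝ (Fin 3)} (hx₀ : S.c₁ * R.Y 0 ≤ ‖s.u (S.τ 0) x₀‖)
    (hp : 0 ≤ ⟪s.u (S.τ 0) x₀, gradient (s.p (S.τ 0)) x₀⟫) :
    ν * frobeniusNormSq (fderiv ℝ (s.u (S.τ 0)) x₀) ≤ S.c₁ * S.c₄ * R.Y 0 ^ 2 := by
  have h1 := s.anchor_inequality_push hν hx₀
  linarith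

/-- **An extension stage IS a continuation with the envelope and the floors** (converse of
`Stage.nonempty_extends_of_continuation`; wide-base rates, margin `routeG`, any level and viscosity):
its own velocity and pressure continue the old stage on `[0, τ (k+1)]` with finite energy, inside the
ceiling `c₂ Y_{k+1}`, meeting the speed floor, the strain floor and the core ledger of level `k + 1`
at `τ (k+1)`. [folklore] -/
theorem exists_continuation_of_extends {S : Schedule TowerRates.wide} {k : ℕ}
    (s : Stage ν TowerRates.wide S (Margins.routeG TowerRates.wide) k)
    (s' : Stage ν TowerRates.wide S (Margins.routeG TowerRates.wide) (k + 1)) (h : s.Extends s') :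
    ∃ (u : ℝ → EuclideanSpace ℝ (Fin 3) → EuclideanSpace ℝ (Fin 3))
      (p : ℝ → EuclideanSpace ℝ (Fin 3) → ℝ),
      IsClassicalNSSolutionOn (Icc 0 (S.τ (k + 1))) ν S.f u p ∧
      (∀ t ∈ Icc 0 (S.τ k), u t = s.u t ∧ p t = s.p t) ∧
      (∃ C : ℝ≥0∞, C < ⊤ ∧ ∀ t ∈ Icc 0 (S.τ (k + 1)), ∫⁻ x, ‖u t x‖ₑ ^ 2 ≤ C) ∧
      (∀ t ∈ Icc 0 (S.τ (k + 1)), ∀ x, ‖u t x‖ ≤ S.c₂ * TowerRates.wide.Y (k + 1)) ∧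
      (∃ x, ‖x‖ ≤ S.radius ∧ S.c₁ * TowerRates.wide.Y (k + 1) ≤ ‖u (S.τ (k + 1)) x‖) ∧
      (∃ x, ‖x‖ ≤ S.radius ∧
        S.c₁ * TowerRates.wide.A (k + 1) ≤ ‖fderiv ℝ (u (S.τ (k + 1))) x‖) ∧
      (∃ (x : EuclideanSpace ℝ (Fin 3)) (γ : ℝ → EuclideanSpace ℝ (Fin 3)),
        ‖x‖ ≤ S.radius ∧ ContDiff ℝ 1 γ ∧ γ 0 = γ 1 ∧
        (∀ σ ∈ Icc (0 : ℝ) 1, γ σ ∈ Metric.closedBall x (1 / TowerRates.wide.N (k + 1))) ∧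
        (∀ σ ∈ Icc (0 : ℝ) 1, ‖deriv γ σ‖ ≤ 8 * π / TowerRates.wide.N (k + 1)) ∧
        S.c₁ * TowerRates.wide.N (k + 1) ^ (TowerRates.wide.β - 2) ≤
          circulation (u (S.τ (k + 1))) γ) :=
  ⟨s'.u, s'.p, s'.classical, h, s'.energy, fun t ht x => s'.ceiling (k + 1) le_rfl t ht x,
    s'.floor (k + 1) le_rfl, s'.routeG_strain (k + 1) le_rfl, s'.routeG_coreLedger (k + 1) le_rfl⟩

end Stage

/-! ## The push constant: at `c₄ = 0` every admissible force is silent from `τ₀` on -/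

namespace Schedule

variable {R : TowerRates} (S : Schedule R)

/-- The growth windows `[τ k, τ (k+1)]` cover `[τ₀, T)`. [folklore] -/
theorem exists_window_of_τ_zero_le {t : ℝ} (h0 : S.τ 0 ≤ t) (hT : t < S.T) :
    ∃ k, t ∈ Icc (S.τ k) (S.τ (k + 1)) := by
  classical
  have hex : ∃ m, t < S.τ (m + 1) := S.exists_lt_τ hT
  refine ⟨Nat.find hex, ?_, (Nat.find_spec hex).le⟩
  rcases (Nat.find hex).eq_zero_or_pos with h | h
  · rw [h]; exact h0
  · have hlt : Nat.find hex - 1 < Nat.find hex := Nat.sub_lt h one_pos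
    have hnot := Nat.find_min hex hlt
    have heq : Nat.find hex - 1 + 1 = Nat.find hex := Nat.sub_add_cancel h
    rw [heq] at hnot
    exact le_of_not_gt hnot

/-- **A force admissible for a schedule with push constant `c₄ = 0` is SILENT FROM `τ₀` ON**: the
window bound `‖g‖ ≤ c₄ Y_k` on every growth window `[τ k, τ (k+1)]` (these cover `[τ₀, T)`) and
silence from `T` on leave `g t x = 0` for all `t ≥ τ₀`. In particular for `g = S.f` (`push_small`,
`force_silent`): a `c₄ = 0` schedule is quiet from its FIRST readout, and so is every re-forcing of
it at the same push constant. [folklore] -/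
theorem admissible_eq_zero_of_c₄_eq_zero (h : S.c₄ = 0)
    {g : ℝ → EuclideanSpace ℝ (Fin 3) → EuclideanSpace ℝ (Fin 3)}
    (hwin : ∀ k, ∀ t ∈ Icc (S.τ k) (S.τ (k + 1)), ∀ x, ‖g t x‖ ≤ S.c₄ * R.Y k)
    (hsil : ∀ t, S.T ≤ t → ∀ x, g t x = 0) {t : ℝ} (ht : S.τ 0 ≤ t)
    (x : EuclideanSpace ℝ (Fin 3)) : g t x = 0 := by
  rcases lt_or_ge t S.T with hT | hT
  · obtain ⟨k, hk⟩ := S.exists_window_of_τ_zero_le ht hT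
    have h1 := hwin k t hk x
    rw [h, zero_mul] at h1
    exact norm_le_zero_iff.1 h1
  · exact hsil t hT x

/-- **A schedule with push constant `c₄ = 0` carries NO force from `τ₀` on.** [folklore] -/
theorem force_eq_zero_of_c₄_eq_zero (h : S.c₄ = 0) {t : ℝ} (ht : S.τ 0 ≤ t)
    (x : EuclideanSpace ℝ (Fin 3)) : S.f t x = 0 :=
  S.admissible_eq_zero_of_c₄_eq_zero h S.push_small S.force_silent ht x

/-- The push constant `c₄ = 0` is compatible with the registered pins: on the wide-base rates with the
registered constants `c₁ = 1`, `c₂ = 5/3` the impulse clause at `c₄ = 0` is the separation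
`(5/3) Y_k ≤ Y_{k+1}` and `sep` at `θ = 6/5` is `2 Y_k ≤ Y_{k+1}` (`TowerRates.wide_sep`), whatever the
times; with confinement of datum and force this is `Pins 8 (6/5)`. [folklore] -/
theorem pins_of_c₄_eq_zero {S : Schedule TowerRates.wide} (h : S.c₄ = 0) (hc₁ : S.c₁ = 1)
    (hc₂ : S.c₂ = 5 / 3) (hd : ∀ x, S.radius < ‖x‖ → S.u₀ x = 0)
    (hf : ∀ t x, S.radius < ‖x‖ → S.f t x = 0) (Λ : ℝ) : S.Pins Λ (6 / 5) := by
  refine ⟨fun k => ?_, fun k => ?_, hd, hf⟩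
  · rw [h, hc₁, hc₂]
    have := TowerRates.wide_sep k
    have hY : 0 < TowerRates.wide.Y k := Real.rpow_pos_of_pos (TowerRates.wide.N_pos k) _
    nlinarith
  · rw [hc₁, hc₂]
    have := TowerRates.wide_sep k
    linarith

end Schedule



end Summit.NavierStokesRegularity.FluidComputer.PalasekTowerClayBridge

end
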